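import Summits.BirchSwinnertonDyer.BirchSwinnertonDyer.Theses.KolyvaginRoadThree
import Summits.BirchSwinnertonDyer.BirchSwinnertonDyer.Theorems.KolyvaginRoadThreeMethod2Eigen
import Summits.BirchSwinnertonDyer.BirchSwinnertonDyer.Theorems.KolyvaginRoadThreeZhangInductionOddStart
import Mathlib.Algebra.Ring.Action.Submonoid
import Mathlib.GroupTheory.OrderOfElement
import HarnessLib

/-!
# Route `KolyvaginRoadThree`, deciding crux `ZhangSharpFrameAtThreeHL` (item stmt-BirchSwinnertonDyer-19574):
# the crux BY NAME from stub B + (A1) rank lowering (or its five local–global inputs) + PARITY OF dim Sel₃(E/K) —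
# stub A's (A6⁰) «non-zero canonical rank at EVERY even level» is not needed
# (cell `bsd-stepL`, seat `bsd-stepL-koly3a` g0, ACCEL-LIST (9); `--supports stmt-BirchSwinnertonDyer-19574`, helper)

HONEST FRAMING. CONDITIONAL compositions; no definition, no named fact, no `sorry`; nothing is booked and the crux is
NOT claimed (the item owner assembles). The registered METHOD skeleton v2u (koly g12 18:35Z; every level quantifier relativised to GOOD levels `GoodLevel W K n`) proves the route decl
`Theses.KolyvaginRoadThree.ZhangSharpFrameAtThreeHL` from stub A = (A1) + (A6⁰) and stub B = realisation + (A2) +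
(A3) + (A5). By `ZhangInduction.exists_ne_zero_of_zhangInduction_on_oddStart` (koly3a, companion file
`KolyvaginRoadThreeZhangInductionOddStart.lean`, relativised to good levels) the induction consults parity ONLY at the starting level: the crux
follows from (A1), stub B and

  (Par) `dim_𝔽₃ Sel₃(E/K)` is ODD at the frame

in place of (A6⁰) — `zhangSharpFrameAtThreeHL_of_rankLowering_of_classes_of_oddSelmerRank` (the companion file
`…Method2CruxOfLocalGlobal.lean` replaces (A1) further by its five named inputs at GOOD primes, koly3a
`Method2.selQ_rankLowering_on_of_localGlobal`). (Par) is
read through zhang3-p1's `finrank_selmer_eq_finrank_selQ_add` (dim Sel₃(E/K) = dim SelQ ∅⁺ + dim SelQ ∅⁻, p457405).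
WHY THIS MATTERS: (A6⁰) above level `∅` is the rank-0 converse for LEVEL-RAISED forms at `p = 3` (koly R-SU3 + B♭
— «hardest» in koly's card; W. Zhang 2014 Thm 7.1), whereas (Par) on a Hoffstein–Luo A1 frame (`r_an(E/K) = 1`) is a
consequence of PUBLISHED theorems only: Gross–Zagier + Kolyvagin (`rank E(K) = 1`, `Ш(E/K)[3^∞]` finite), the
Cassels–Tate alternating pairing (`dim_𝔽₃ Ш(E/K)[3]` even) and `E(K)[3] = 0` (surjective `ρ̄_{E,3}`); the rank-0
converse then enters the crux ONLY through stub B's base case (A5) (Zhang Thm 7.2), exactly as in print. Stub A as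
registered IMPLIES (A1) trivially, so nothing is lost; the planner may reshape stub A to (A1) ∧ (Par).
PARTITION: O2@3 (B10) × A1 × crux 19574 — none (conditional composition; closes nothing; T7).

References: [cite: WZhang2014, §9 proof of Thm. 9.1, Thm. 9.2, Lemma 8.4, Thm. 4.3, Thm. 7.2, Prop. 5.4, Lemma 7.3]
[cite: BertoliniDarmon2005, Lemma 2.6, Thm. 3.2] [cite: GrossLMS1991, §5 (5.1)].
-/

noncomputable section

open scoped Classical

namespace Summit.BirchSwinnertonDyer.Rank1Residual.X11b.Three.Koly.Method2

open WeierstrassCurve NumberField IsDedekindDomain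
  Literature.NumberTheory.EllipticCurves Literature.NumberTheory.EllipticCurves.ModularForms
  Literature.NumberTheory.GaloisRepresentations Module

/-! ## §0 Complex conjugation of an imaginary quadratic field -/

/-- Complex conjugation exists: an imaginary quadratic field has a `ℚ`-automorphism `c ≠ 1`, and `c² = 1`
(`|Aut(K/ℚ)| = [K : ℚ] = 2`). (koly g11's skeleton lemma, with the involution property added.) [folklore] -/
theorem exists_algEquiv_ne_one_mul_self_eq_one (K : Type) [Field K] [NumberField K] (hK : IsImaginaryQuadratic K) :
    ∃ c : K ≃ₐ[ℚ] K, c ≠ 1 ∧ c * c = 1 := by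
  haveI : Algebra.IsQuadraticExtension ℚ K := ⟨hK.1⟩
  have hcard : Nat.card (K ≃ₐ[ℚ] K) = 2 := by rw [IsGalois.card_aut_eq_finrank, hK.1]
  haveI : Finite (K ≃ₐ[ℚ] K) := Nat.finite_of_card_ne_zero (by rw [hcard]; decide)
  haveI : Nontrivial (K ≃ₐ[ℚ] K) := Finite.one_lt_card_iff_nontrivial.mp (by rw [hcard]; decide)
  obtain ⟨c, hc⟩ := exists_ne (1 : K ≃ₐ[ℚ] K)
  refine ⟨c, hc, ?_⟩
  have h2 : orderOf c ∣ 2 := hcard ▸ orderOf_dvd_natCard c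
  rw [← pow_two]
  exact orderOf_dvd_iff_pow_eq_one.mp h2

/-! ## §1 The crux from (A1) + stub B + parity of dim Sel₃(E/K) -/

/-- **`ZhangSharpFrameAtThreeHL` BY NAME from (A1) rank lowering, stub B, and the PARITY of `dim_𝔽₃ Sel₃(E/K)` —
no (A6⁰) above level `∅`.** Hypotheses, frame-wise on the Hoffstein–Luo A1 frames, for every complex conjugation
`c ≠ 1` with `c² = 1` and the `ZMod 3`-structure of `H¹(K, E[3])`: (hA1) the (A1)-conjunct of the registered stub A,
v2u text (rank lowering at one new GOOD unipotent-admissible prime with the (9.1)–(9.2) bookkeeping, on good levels,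
for the canonical `SelQ`); (hB) the registered stub B `stub_kolyvaginClassesAtThree` (v2u text: realisation + (A2) +
(A3) with finiteness + (A5), on good levels) AS A HYPOTHESIS; (hPar) `Odd (dim_𝔽₃ Sel₃(E/K))` (tree `selmerGroup (W.baseChange K) 3`). Proof: complex
conjugation (`exists_algEquiv_ne_one_mul_self_eq_one`), the `ZMod 3`-structure (`zsmul_discreteH1_torsion`),
(Par) ⟹ odd rank at level `∅` (zhang3-p1 `finrank_selmer_eq_finrank_selQ_add`), (A4) = `relaxation_le`, and the
odd-start engine `ZhangInduction.exists_ne_zero_of_zhangInduction_on_oddStart` (good levels; `goodLevel_empty`); the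
non-zero bottom class is a concrete Kolyvagin class by the realisation identity. CONDITIONAL; nothing is booked.
[cite: WZhang2014, §9 proof of Thm. 9.1 and Thm. 9.2] -/
theorem zhangSharpFrameAtThreeHL_of_rankLowering_of_classes_of_oddSelmerRank
    (hA1 : ∀ (W : WeierstrassCurve ℚ) [W.IsElliptic] [W.IsGloballyMinimal] [NeZero (W.conductorNorm ℤ)] (K : Type)
      [Field K] [NumberField K] (Dt : ModularParametrizationData W (W.conductorNorm ℤ)) (β : ℤ) (ι : K →+* ℂ),
      Summit.BirchSwinnertonDyer.Rank1Residual.ClassX11b W 3 → W.HasMultiplicativeReductionAtPrime 3 →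
      Literature.NumberTheory.EllipticCurves.Rank1Residual.Surj W 3 →
      Literature.NumberTheory.EllipticCurves.Rank1Residual.Ram W 3 → ¬ 3 ∣ W.tamagawaProduct →
      IsImaginaryQuadratic K → Odd (NumberField.discr K) → SatisfiesHeegnerHypothesis (W.conductorNorm ℤ) K →
      (W.quadraticTwist (NumberField.discr K : ℚ)).entireLFunction 1 ≠ 0 → NumberField.discr K ≠ -3 →
      (4 * (W.conductorNorm ℤ : ℤ)) ∣ β ^ 2 - NumberField.discr K → ¬ (3 : ℤ) ∣ Dt.c →
      ∀ (c : K ≃ₐ[ℚ] K), c ≠ 1 → ∀ [Module (ZMod 3) (V3 W K)],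
      ∀ (n : Finset {q // IsUAdmissiblePrime W K q}) (μ : Bool) (x : V3 W K),
        GoodLevel W K n → x ∈ SelQ W K c n μ → x ≠ 0 →
        ∃ q : {q // IsUAdmissiblePrime W K q}, q ∉ n ∧ GoodLevel W K (insert q n) ∧
          x ∉ SelQ W K c (insert q n) μ ∧
          SelQ W K c (insert q n) μ ≤ SelQ W K c n μ ∧
          finrank (ZMod 3) (SelQ W K c (insert q n) μ) + 1 = finrank (ZMod 3) (SelQ W K c n μ) ∧
          SelQ W K c (insert q n) (!μ) = SelQ W K c n (!μ))
    (hB : ∀ (W : WeierstrassCurve ℚ) [W.IsElliptic] [W.IsGloballyMinimal] [NeZero (W.conductorNorm ℤ)] (K : Type)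
      [Field K] [NumberField K] (Dt : ModularParametrizationData W (W.conductorNorm ℤ)) (β : ℤ) (ι : K →+* ℂ),
      Summit.BirchSwinnertonDyer.Rank1Residual.ClassX11b W 3 → W.HasMultiplicativeReductionAtPrime 3 →
      Literature.NumberTheory.EllipticCurves.Rank1Residual.Surj W 3 →
      Literature.NumberTheory.EllipticCurves.Rank1Residual.Ram W 3 → ¬ 3 ∣ W.tamagawaProduct →
      IsImaginaryQuadratic K → Odd (NumberField.discr K) → SatisfiesHeegnerHypothesis (W.conductorNorm ℤ) K →
      (W.quadraticTwist (NumberField.discr K : ℚ)).entireLFunction 1 ≠ 0 → NumberField.discr K ≠ -3 →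
      (4 * (W.conductorNorm ℤ : ℤ)) ∣ β ^ 2 - NumberField.discr K → ¬ (3 : ℤ) ∣ Dt.c →
      ∀ (c : K ≃ₐ[ℚ] K), c ≠ 1 → ∀ [Module (ZMod 3) (V3 W K)],
      ∃ (κ : {x : (n : ℕ) × KolyvaginHeegnerData Dt β ι n //
              KolyvaginDescent.KolSupp (Zhang2014.IsKolyvaginPrime (W.conductorNorm ℤ) W K 3) x.1} →
            Finset {q // IsUAdmissiblePrime W K q} → V3 W K)
        (m₁ : {x : (n : ℕ) × KolyvaginHeegnerData Dt β ι n //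
              KolyvaginDescent.KolSupp (Zhang2014.IsKolyvaginPrime (W.conductorNorm ℤ) W K 3) x.1}),
        (∀ m, κ m ∅ = m.1.2.kolyvaginClass Nat.prime_three 1) ∧
        (∀ (n : Finset {q // IsUAdmissiblePrime W K q}) (q₁ q₂ : {q // IsUAdmissiblePrime W K q}),
          GoodLevel W K n → GoodLevel W K (insert q₁ n) → GoodLevel W K (insert q₂ (insert q₁ n)) →
          q₁ ∉ n → q₂ ∉ insert q₁ n → q₂ ∉ baseLocusQ W K κ (insert q₂ (insert q₁ n)) → ∃ m, κ m n ≠ 0) ∧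
        (∀ (n : Finset {q // IsUAdmissiblePrime W K q}), GoodLevel W K n → Even n.card → (∃ m, κ m n ≠ 0) →
          ∃ (s : Bool) (d : ℕ), finrank (ZMod 3) (SelQ W K c n s) = d + 1 ∧
            SelQ W K c n s = SelRelQ W K c n (baseLocusQ W K κ n) s ∧
            FiniteDimensional (ZMod 3) (SelRelQ W K c n (baseLocusQ W K κ n) (!s)) ∧
            finrank (ZMod 3) (SelRelQ W K c n (baseLocusQ W K κ n) (!s)) ≤ d) ∧
        (∀ (n : Finset {q // IsUAdmissiblePrime W K q}), GoodLevel W K n → Even n.card →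
          finrank (ZMod 3) (SelQ W K c n true) + finrank (ZMod 3) (SelQ W K c n false) = 1 → κ m₁ n ≠ 0))
    (hPar : ∀ (W : WeierstrassCurve ℚ) [W.IsElliptic] [W.IsGloballyMinimal] [NeZero (W.conductorNorm ℤ)] (K : Type)
      [Field K] [NumberField K] (Dt : ModularParametrizationData W (W.conductorNorm ℤ)) (β : ℤ) (ι : K →+* ℂ),
      Summit.BirchSwinnertonDyer.Rank1Residual.ClassX11b W 3 → W.HasMultiplicativeReductionAtPrime 3 →
      Literature.NumberTheory.EllipticCurves.Rank1Residual.Surj W 3 →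
      Literature.NumberTheory.EllipticCurves.Rank1Residual.Ram W 3 → ¬ 3 ∣ W.tamagawaProduct →
      IsImaginaryQuadratic K → Odd (NumberField.discr K) → SatisfiesHeegnerHypothesis (W.conductorNorm ℤ) K →
      (W.quadraticTwist (NumberField.discr K : ℚ)).entireLFunction 1 ≠ 0 → NumberField.discr K ≠ -3 →
      (4 * (W.conductorNorm ℤ : ℤ)) ∣ β ^ 2 - NumberField.discr K → ¬ (3 : ℤ) ∣ Dt.c →
      ∀ [Module (ZMod 3) (V3 W K)],
      Odd (finrank (ZMod 3) (AddSubgroup.toZModSubmodule 3 (selmerGroup (W.baseChange K) ((3 ^ 1 : ℕ) : ℤ))))) :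
    Summit.BirchSwinnertonDyer.BirchSwinnertonDyer.Theses.KolyvaginRoadThree.ZhangSharpFrameAtThreeHL := by
  intro W _ _ _ K _ _ Dt β ι hX hmult hsurj hram htam hK hodd hH hLt h3 hβ hc
  obtain ⟨c, hc1, hcc⟩ := exists_algEquiv_ne_one_mul_self_eq_one K hK
  -- the unique `ZMod 3`-module structure on `H¹(K, E[3])`
  letI : Module (ZMod 3) (V3 W K) :=
    AddCommGroup.zmodModule (fun x ↦ by
      have h := zsmul_discreteH1_torsion ((3 ^ 1 : ℕ) : ℤ) x
      rw [natCast_zsmul] at h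
      simpa using h)
  have hA1' := hA1 W K Dt β ι hX hmult hsurj hram htam hK hodd hH hLt h3 hβ hc c hc1
  obtain ⟨κ, m₁, hbot, hA2, hA3, hA5⟩ := hB W K Dt β ι hX hmult hsurj hram htam hK hodd hH hLt h3 hβ hc c hc1
  have hPar' := hPar W K Dt β ι hX hmult hsurj hram htam hK hodd hH hLt h3 hβ hc
  -- parity at the bottom: dim Sel₃(E/K) = dim SelQ ∅⁺ + dim SelQ ∅⁻
  rw [finrank_selmer_eq_finrank_selQ_add W K hK c hcc] at hPar'
  have hA4 : ∀ (n : Finset {q // IsUAdmissiblePrime W K q}) (q : {q // IsUAdmissiblePrime W K q})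
      (S : Set {q // IsUAdmissiblePrime W K q}) (s : Bool), GoodLevel W K n → GoodLevel W K (insert q n) →
      q ∉ n → q ∈ S → SelQ W K c n s ≤ SelRelQ W K c (insert q n) S s :=
    fun n q S s _ _ hqn hqS ↦ relaxation_le W K c n q S s hqn hqS
  obtain ⟨m, hm⟩ :=
    Summit.BirchSwinnertonDyer.Rank1Residual.X11b.Three.Koly.ZhangInduction.exists_ne_zero_of_zhangInduction_on_oddStart
      (GoodLevel W K) (SelQ W K c) (SelRelQ W K c) (baseLocusQ W K κ) κ m₁ hA1' hA2 hA3 hA4 hA5 ∅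
      (goodLevel_empty W K) (by simp) hPar'
  refine ⟨m.1.1, m.1.2, m.2, fun h0 ↦ hm ?_⟩
  rw [hbot m, h0]

/-! ## §2 (sequel) The same with (A1) replaced by its five good-prime local–global inputs
(`Method2.selQ_rankLowering_on_of_localGlobal`, `Theorems/KolyvaginRoadThreeMethod2RankLoweringGood.lean`) is the
companion file `Theorems/KolyvaginRoadThreeMethod2CruxOfLocalGlobal.lean`. -/

end Summit.BirchSwinnertonDyer.Rank1Residual.X11b.Three.Koly.Method2

end
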